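import Literature.Probability.FitznerVanDerHofstad2017.NobleBoundsN1IotaCls20
import Literature.Probability.FitznerVanDerHofstad2017.NobleRerouteJointWitIota
import Literature.Probability.FitznerVanDerHofstad2017.NobleBoundsN1Class01
import HarnessLib

/-!
# Fitzner–van der Hofstad (2017), §6.1: the class `(a,b) = (1,0)` of (6.4) at `N = 1` for the `ι`-event

[FvdH17] = R. Fitzner, R. van der Hofstad, *Mean-field behavior for nearest-neighbor percolation in `d > 10`*,
Electron. J. Probab. **22** (2017), no. 43, arXiv:1506.07977v2; §6.1 proof of Lemma 5.3 (pp. 58–59):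
"Case `a = 1`" of the `Ξ^ι` start ("we conclude from `a = 1` that `u` and `w` are neighbors"), "Case `a = 1`,
`b = 0`" of the middle piece, the `b = 0` right triangle; App. B rows `b = 1` of `P^{ι,b}` (p. 73).

The class estimate `h2 (1,0)` of `NobleBoundsN1IotaReduce.tsum_ofReal_nobleXiIotaN_one_le_of_cls₁₂` for the event
`E ι x = NobleJointTwoLevelIota.jointWitIota ι x`:
`J(v−u) ℙ_p^{⊗2}(jointWitIota ∩ class (1,0)) ≤ Σ_κ 𝟙{v = u+e_κ} P^{ι,1}(u,w) Ā'^{κ,1,0}(u,w,t,z) P^{E,0}(t−x,z−x)`.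
Absorbed style (`NobleBoundsN1IotaCls20` pattern: `p = J(v−u)` becomes the open bond `b₀ = (u,v)` at level `0`,
the line `{u ←1̲→ v}` of `Ā^{κ,1,0}`; middle `NobleBoundsN1ClassTools.piPerc_mid_one_zero_le_blockAbar'`, end
`piPerc_end_zero_le_blockPE`) on the class `z = t`.  In class `a = 1` the bond `(u,w)` is open at level `0`; the
level-`0` witnesses are first RE-ROUTED onto it (`NobleRerouteJointWitIota`), after which the start is `P^{ι,1}`:
for `u = e_ι` only part `II` is live (`{0 ←2→ w} ∘ {w ←1̲→ e_ι}`, row `one_base`), for `u ≠ e_ι` only part `I`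
(rows `one_eq` for `w = e_ι`, `one_ne` for `w ≠ e_ι`).  If `(u,w)` is not a lattice bond the class is null.
Unconditional, every `d` and `p`.
-/

namespace Literature.Probability.FitznerVanDerHofstad2017

open Literature.Barriers.CriticalPhenomena Literature.Probability.Percolation Literature.Probability.LatticeModels
open Literature.Combinatorics.SimpleGraph _root_.SimpleGraph _root_.MeasureTheory
open Literature.Probability.FitznerVanDerHofstad2017.NobleBlocks
open Literature.Probability.FitznerVanDerHofstad2017.NobleBlocks.LenIdx
open scoped ENNReal BigOperators

variable {d : ℕ}

namespace IotaCls10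

/-! ### The level-`0` line families after re-routing (assembled by `IotaCls20.mk`) -/

/-- Part `II`, `u = e`: `{0 ←2→ w}, {w ←1̲→ e}, {e↔e}, {e↔e}, {t↔w}`. [cite: FitznerVanDerHofstad2017, §6.1 Case a = 1 (arXiv:1506.07977v2 p. 59)] -/
def l0B (e w t : Site d) : Fin 5 → Set (BondConfig (Site d)) :=
  ![event (ge 2) 0 w, event (eq 1) w e, event (ge 0) e e, event (ge 0) e e, event (ge 0) t w]

/-- Part `I`, `u ≠ e`, `w ≠ e`: `{0 ←3→ e}, {e ←1→ w}, {w ←1̲→ u}, {t↔w}, {u ←1→ e}`. [cite: FitznerVanDerHofstad2017, §6.1 Case a = 1 (arXiv:1506.07977v2 p. 59)] -/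
def l0Iw (e u w t : Site d) : Fin 5 → Set (BondConfig (Site d)) :=
  ![event (ge 3) 0 e, event (ge 1) e w, event (eq 1) w u, event (ge 0) t w, event (ge 1) u e]

/-- Part `I`, `u ≠ e`, `w = e`: `{0 ←3→ e}, {e↔e}, {u ←1̲→ e}, {t↔e}, {e ←3→ u}`. [cite: FitznerVanDerHofstad2017, §6.1 Case a = 1 (arXiv:1506.07977v2 p. 59)] -/
def l0Ie (e u t : Site d) : Fin 5 → Set (BondConfig (Site d)) :=
  ![event (ge 3) 0 e, event (ge 0) e e, event (eq 1) u e, event (ge 0) t e, event (ge 3) e u]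

/-- [cite: FitznerVanDerHofstad2017, §4.2 Def. 4.1 (arXiv:1506.07977v2 p. 35)] -/
theorem isFinitary_l0B (e w t : Site d) : ∀ i, IsFinitary (l0B (d := d) e w t i) := by
  intro i; fin_cases i
  exacts [isFinitary_event (ge 2) 0 w, isFinitary_event (eq 1) w e, isFinitary_event (ge 0) e e,
    isFinitary_event (ge 0) e e, isFinitary_event (ge 0) t w]

/-- [cite: FitznerVanDerHofstad2017, §4.2 Def. 4.1 (arXiv:1506.07977v2 p. 35)] -/
theorem isFinitary_l0Iw (e u w t : Site d) : ∀ i, IsFinitary (l0Iw (d := d) e u w t i) := by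
  intro i; fin_cases i
  exacts [isFinitary_event (ge 3) 0 e, isFinitary_event (ge 1) e w, isFinitary_event (eq 1) w u,
    isFinitary_event (ge 0) t w, isFinitary_event (ge 1) u e]

/-- [cite: FitznerVanDerHofstad2017, §4.2 Def. 4.1 (arXiv:1506.07977v2 p. 35)] -/
theorem isFinitary_l0Ie (e u t : Site d) : ∀ i, IsFinitary (l0Ie (d := d) e u t i) := by
  intro i; fin_cases i
  exacts [isFinitary_event (ge 3) 0 e, isFinitary_event (ge 0) e e, isFinitary_event (eq 1) u e,
    isFinitary_event (ge 0) t e, isFinitary_event (ge 3) e u]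

/-! ### Facts of the class -/

/-- On `jointWitIota ∩ class (1,0)`: the side conditions, the open bond `(u,w)` (`u ≠ w`), and `t = z`.
[cite: FitznerVanDerHofstad2017, §6.1 "Case a = 1", "b = 0" (arXiv:1506.07977v2 pp. 58–59)] -/
theorem facts {ι : Fin d × Bool} {x u v w z t : Site d} {ω : Fin 2 → BondConfig (Site d)}
    (hω : ω ∈ jointWitIota ι x u v w z t ∩ clsSet u w t z 1 0) :
    JWιSide u v w z t x ∧ (u ≠ w ∧ s(u, w) ∈ ω 0) ∧ t = z := by
  have hs : JWιSide u v w z t x := by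
    rcases hω.1 with h | h
    exacts [h.1, h.1]
  exact ⟨hs, (mem_lineCls_one_iff u w 0 ω).1 hω.2.1, (mem_lineCls_zero_iff t z 1 ω).1 hω.2.2⟩

/-- A class-`1` event off the lattice is null (file-private copy of `IotaCls12.piPerc_eq_zero_of_not_adj`). [folklore] -/
private theorem piPerc_eq_zero_of_not_adj₀ (p : unitInterval) {S : Set (Fin 2 → BondConfig (Site d))}
    {u w : Site d} (hS : ∀ ω ∈ S, s(u, w) ∈ ω 0) (h : ¬ (zdGraph d).Adj u w) : piPerc d p 2 S = 0 := by
  refine le_antisymm ((piPerc_le_inter_lattice₀ p S).trans (le_of_eq ?_)) zero_le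
  have h0 : S ∩ {ω | ω 0 ⊆ (zdGraph d).edgeSet} = ∅ :=
    Set.eq_empty_iff_forall_notMem.2 fun ω hω => h ((SimpleGraph.mem_edgeSet _).1 (hω.2 (hS ω hω.1)))
  rw [h0, measure_empty]

end IotaCls10

open IotaCls10
open IotaCls20 (mk isFinitary_mk up₁)

section

variable (p : unitInterval)

/-- **Class `(1,0)`, `u = e_ι`**: only part `II` is live; after re-routing onto the open bond `(e_ι,w)` the start is
`{0 ←2→ w} ∘ {w ←1̲→ e_ι} ≤ P^{ι,1}(e_ι,w)`.
[cite: FitznerVanDerHofstad2017, §6.1 proof of Lemma 5.3, Case a = 1 with `u = e_ι`, "Case a = 1, b = 0" (arXiv:1506.07977v2 p. 59)] -/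
theorem jointWitIota_cls_one_zero_of_eq {ι : Fin d × Bool} {u : Site d} (hu : u = stepVec ι) (x v w z t : Site d) :
    ENNReal.ofReal (bondJ d p (v - u)) * piPerc d p 2 (jointWitIota ι x u v w z t ∩ clsSet u w t z 1 0) ≤
      ∑ κ : Fin d × Bool, (if v = u + stepVec κ then (1 : ℝ≥0∞) else 0) *
        (blockPiota (Letters.perc d p) ι 1 u w * blockAbar' (Letters.perc d p) κ 1 0 u w t z *
          blockPE (Letters.perc d p) 0 (t - x) (z - x)) := by
  classical
  refine ofReal_bondJ_mul_le_sum_ite p u v _ _ fun κ hv => ?_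
  by_cases hne : (jointWitIota ι x u v w z t ∩ clsSet u w t z 1 0).Nonempty
  swap
  · rw [Set.not_nonempty_iff_eq_empty.1 hne, measure_empty, mul_zero]; exact zero_le
  obtain ⟨ω₀, hω₀⟩ := hne
  obtain ⟨hs, -, hzt⟩ := facts hω₀
  subst hzt
  have hvt : v ≠ t := fun h => hs.2.2.2.1 h.symm
  have htu : t ≠ u := hs.2.2.2.2.1
  have huv : u ≠ v := (adj_of_eq_add_stepVec hv).ne
  rw [jointWitIota_inter_eq_of_I (jointWitIotaI_inter_clsSet_eq_empty_of_eq hu x v w t t (a := 1) (by decide) 0)]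
  subst hu
  rw [ofReal_mul_piPerc_eq_inter_of_preimage p hv
    ((measurableSet_jointWitIotaII ι x (stepVec ι) v w t t).inter (measurableSet_clsSet (stepVec ι) w t t 1 0))
    (eraseAt0_preimage_jointWitIotaII_inter_clsSet ι x (stepVec ι) v w t t 1 0)]
  -- the class bond must be a lattice bond
  by_cases hadjw : (zdGraph d).Adj (stepVec ι) w
  swap
  · rw [piPerc_eq_zero_of_not_adj₀ p (fun ω hω => ((mem_lineCls_one_iff _ w 0 ω).1 hω.2.2.1).2) hadjw]
    exact zero_le
  obtain ⟨κ', hw⟩ := (zdGraph_adj_iff_stepVec (stepVec ι) w).1 hadjw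
  have h3 := piPerc_inter_le_prod₃_of_witnessedι₀ p
    (E := jointWitIotaII ι x (stepVec ι) v w t t ∩ clsSet (stepVec ι) w t t 1 0) (C := clsSet (stepVec ι) w t t 1 0)
    (fun ω hω => jointWitnessedι_pinII_of_mem hω.1 ((mem_lineCls_one_iff _ w 0 ω).1 hω.2.1).2)
    (mk (l0B (stepVec ι) w t) (stepVec ι) v t x) (isFinitary_mk (isFinitary_l0B _ w t) _ v t x) grpιII₀
    grpιII₀_adm
    (fun ω hω hlat i K hK _ hL hI _ => by
      have hcl := (mem_lineCls_one_iff (stepVec ι) w 0 ω).1 hω.2.1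
      have hw0 : w ≠ 0 := (eq_and_ne_zero_of_mem_II_cls_one hω.1).2
      have hwe : w ≠ stepVec ι := (sideII_of_mem hω.1.1).2.1
      fin_cases i
      · -- `{0 ↔ w}` avoiding `(e,w)`: `|w| = 2` by parity, so `{0 ←2→ w}`
        have hL' : K ∈ (openConn (0 : Site d) w : Set (BondConfig (Site d))) ∧ s(stepVec ι, w) ∉ K := hL
        exact mem_openConnGe_two_of_notMem hL'.1 hw0.symm fun h0w =>
          not_adj_of_adj_adj (adj_zero_stepVec' ι) ((SimpleGraph.mem_edgeSet _).1 (hlat hcl.2))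
            ((SimpleGraph.mem_edgeSet _).1 (hlat (hK h0w)))
      · -- the bond
        have hL' : K = {s(stepVec ι, w)} := hL
        rw [hL']
        exact mem_openConnEq_one_of_mem hwe (Set.mem_singleton_iff.2 Sym2.eq_swap)
      · have hL' : K = ∅ := hL
        rw [hL']
        exact mem_openConnGe_zero_of_mem
          (show (openGraph (∅ : BondConfig (Site d))).Reachable (stepVec ι) (stepVec ι) from .refl _)
      · have hL' : K = ∅ := hL
        rw [hL']
        exact mem_openConnGe_zero_of_mem
          (show (openGraph (∅ : BondConfig (Site d))).Reachable (stepVec ι) (stepVec ι) from .refl _)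
      · have hL' : K ∈ (openConn w t : Set (BondConfig (Site d))) ∧ s(stepVec ι, w) ∉ K := hL
        exact mem_openConnGe_zero_of_mem (SimpleGraph.Reachable.symm hL'.1))
    (mem_openConnEq_one_of_mem huv (Set.mem_singleton _)) (up₁ hvt)
  rw [Set.inter_assoc, Set.inter_self] at h3
  refine h3.trans (mul_le_mul' (mul_le_mul' ?_ ?_) ?_)
  · exact piPerc_grp_le _ _ _ 0 ![Sum.inl (Sum.inl 0), Sum.inl (Sum.inl 1)] (by decide) (by decide)
      (by funext m; fin_cases m <;> rfl) (piPerc_iotaStart_one_base_le_blockPiota p ι w _)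
  · exact piPerc_grp_le _ _ _ 1 ![Sum.inl (Sum.inr 0), Sum.inr 0, Sum.inl (Sum.inl 4)] (by decide) (by decide)
      (by funext m; fin_cases m <;> rfl) (piPerc_mid_one_zero_le_blockAbar' p hv hw rfl htu _)
  · exact piPerc_grp_le _ _ _ 2 ![Sum.inr 2, Sum.inr 3] (by decide) (by decide)
      (by funext m; fin_cases m <;> rfl) (piPerc_end_zero_le_blockPE p rfl _ rfl)

/-- **Class `(1,0)`, `u ≠ e_ι`**: only part `I` is live (clause C1); after re-routing onto the open bond `(u,w)` the
start is `P^{ι,1}(u,w)` (rows `one_eq` for `w = e_ι`, `one_ne` for `w ≠ e_ι`).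
[cite: FitznerVanDerHofstad2017, §6.1 proof of Lemma 5.3, Case a = 1 with `u ≠ e_ι`, "Case a = 1, b = 0"; App. B rows b=1 of P^{ι,b} (arXiv:1506.07977v2 pp. 59, 73)] -/
theorem jointWitIota_cls_one_zero_of_ne {ι : Fin d × Bool} {u : Site d} (hu : u ≠ stepVec ι) (x v w z t : Site d) :
    ENNReal.ofReal (bondJ d p (v - u)) * piPerc d p 2 (jointWitIota ι x u v w z t ∩ clsSet u w t z 1 0) ≤
      ∑ κ : Fin d × Bool, (if v = u + stepVec κ then (1 : ℝ≥0∞) else 0) *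
        (blockPiota (Letters.perc d p) ι 1 u w * blockAbar' (Letters.perc d p) κ 1 0 u w t z *
          blockPE (Letters.perc d p) 0 (t - x) (z - x)) := by
  classical
  refine ofReal_bondJ_mul_le_sum_ite p u v _ _ fun κ hv => ?_
  by_cases hne : (jointWitIota ι x u v w z t ∩ clsSet u w t z 1 0).Nonempty
  swap
  · rw [Set.not_nonempty_iff_eq_empty.1 hne, measure_empty, mul_zero]; exact zero_le
  obtain ⟨ω₀, hω₀⟩ := hne
  obtain ⟨hs, ⟨huw, -⟩, hzt⟩ := facts hω₀
  subst hzt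
  have hvt : v ≠ t := fun h => hs.2.2.2.1 h.symm
  have htu : t ≠ u := hs.2.2.2.2.1
  have huv : u ≠ v := (adj_of_eq_add_stepVec hv).ne
  rw [jointWitIota_inter_eq_of_II (jointWitIotaII_inter_clsSet_one_eq_empty_of_ne hu x v w t t 0)]
  rw [ofReal_mul_piPerc_eq_inter_of_preimage p hv
    ((measurableSet_jointWitIotaI ι x u v w t t).inter (measurableSet_clsSet u w t t 1 0))
    (eraseAt0_preimage_jointWitIotaI_inter_clsSet ι x u v w t t 1 0)]
  -- the class bond must be a lattice bond
  by_cases hadjw : (zdGraph d).Adj u w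
  swap
  · rw [piPerc_eq_zero_of_not_adj₀ p (fun ω hω => ((mem_lineCls_one_iff u w 0 ω).1 hω.2.2.1).2) hadjw]
    exact zero_le
  obtain ⟨κ', hw⟩ := (zdGraph_adj_iff_stepVec u w).1 hadjw
  have hE : ∀ ω ∈ jointWitIotaI ι x u v w t t ∩ clsSet u w t t 1 0,
      JointWitnessedι (jwιLinesIpin (stepVec ι) u w t) {3} s((0 : Site d), stepVec ι) t v t x
        (offBonds {s(u, v)} (ω 0)) (offBonds (bondsAt {u}) (ω 1)) :=
    fun ω hω => jointWitnessedι_pinI_of_mem hu hω.1 ((mem_lineCls_one_iff u w 0 ω).1 hω.2.1).2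
  by_cases hwe : w = stepVec ι
  · -- `w = e_ι`: `{0 ←3→ e}, {e ←3→ u}` (the avoiding `{e↔u}` witness, parity) and the bond `{u ←1̲→ e}`
    subst hwe
    have h3 := piPerc_inter_le_prod₃_of_witnessedι₀ p
      (E := jointWitIotaI ι x u v (stepVec ι) t t ∩ clsSet u (stepVec ι) t t 1 0) (C := clsSet u (stepVec ι) t t 1 0)
      hE (mk (l0Ie (stepVec ι) u t) u v t x) (isFinitary_mk (isFinitary_l0Ie _ u t) u v t x) grpιI₀ grpιI₀_adm
      (fun ω hω hlat i K hK _ hL hI _ => by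
        fin_cases i
        · have hL' : K ∈ (openConn (0 : Site d) (stepVec ι) : Set (BondConfig (Site d))) ∧
            s(u, stepVec ι) ∉ K := hL
          exact mem_event_ge_three_zero_stepVec hlat hK hL'.1 (hI (by decide))
        · have hL' : K ∈ (openConn (stepVec ι) (stepVec ι) : Set (BondConfig (Site d))) ∧
            s(u, stepVec ι) ∉ K := hL
          exact mem_openConnGe_zero_of_mem hL'.1
        · have hL' : K = {s(u, stepVec ι)} := hL
          rw [hL']
          exact mem_openConnEq_one_of_mem hu (Set.mem_singleton _)
        · have hL' : K ∈ (openConn (stepVec ι) t : Set (BondConfig (Site d))) ∧ s(u, stepVec ι) ∉ K := hL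
          exact mem_openConnGe_zero_of_mem (SimpleGraph.Reachable.symm hL'.1)
        · have hL' : K ∈ (openConn (stepVec ι) u : Set (BondConfig (Site d))) ∧ s(u, stepVec ι) ∉ K := hL
          exact mem_openConnGe_three_of_notMem (hK.trans hlat) hadjw.symm hL'.1
            (by rw [Sym2.eq_swap]; exact hL'.2))
      (mem_openConnEq_one_of_mem huv (Set.mem_singleton _)) (up₁ hvt)
    rw [Set.inter_assoc, Set.inter_self] at h3
    refine h3.trans (mul_le_mul' (mul_le_mul' ?_ ?_) ?_)
    · exact piPerc_grp_le _ _ _ 0 ![Sum.inl (Sum.inl 0), Sum.inl (Sum.inl 4), Sum.inl (Sum.inl 2)] (by decide)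
        (by decide) (by funext m; fin_cases m <;> rfl) (piPerc_iotaStart_one_eq_le_blockPiota p ι u _)
    · exact piPerc_grp_le _ _ _ 1 ![Sum.inl (Sum.inr 0), Sum.inr 0, Sum.inl (Sum.inl 3)] (by decide) (by decide)
        (by funext m; fin_cases m <;> rfl) (piPerc_mid_one_zero_le_blockAbar' p hv hw rfl htu _)
    · exact piPerc_grp_le _ _ _ 2 ![Sum.inr 2, Sum.inr 3] (by decide) (by decide)
        (by funext m; fin_cases m <;> rfl) (piPerc_end_zero_le_blockPE p rfl _ rfl)
  · -- `w ≠ e_ι`: `{0 ←3→ e}` and the triangle `{e ←1→ w}, {w ←1̲→ u}, {u ←1→ e}`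
    have h3 := piPerc_inter_le_prod₃_of_witnessedι₀ p
      (E := jointWitIotaI ι x u v w t t ∩ clsSet u w t t 1 0) (C := clsSet u w t t 1 0)
      hE (mk (l0Iw (stepVec ι) u w t) u v t x) (isFinitary_mk (isFinitary_l0Iw _ u w t) u v t x) grpιI₀ grpιI₀_adm
      (fun ω hω hlat i K hK _ hL hI _ => by
        fin_cases i
        · have hL' : K ∈ (openConn (0 : Site d) (stepVec ι) : Set (BondConfig (Site d))) ∧ s(u, w) ∉ K := hL
          exact mem_event_ge_three_zero_stepVec hlat hK hL'.1 (hI (by decide))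
        · have hL' : K ∈ (openConn (stepVec ι) w : Set (BondConfig (Site d))) ∧ s(u, w) ∉ K := hL
          exact mem_openConnGe_one_of_ne hL'.1 (Ne.symm hwe)
        · have hL' : K = {s(u, w)} := hL
          rw [hL']
          exact mem_openConnEq_one_of_mem (Ne.symm huw) (Set.mem_singleton_iff.2 Sym2.eq_swap)
        · have hL' : K ∈ (openConn w t : Set (BondConfig (Site d))) ∧ s(u, w) ∉ K := hL
          exact mem_openConnGe_zero_of_mem (SimpleGraph.Reachable.symm hL'.1)
        · have hL' : K ∈ (openConn (stepVec ι) u : Set (BondConfig (Site d))) ∧ s(u, w) ∉ K := hL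
          exact mem_openConnGe_one_of_ne (SimpleGraph.Reachable.symm hL'.1) hu)
      (mem_openConnEq_one_of_mem huv (Set.mem_singleton _)) (up₁ hvt)
    rw [Set.inter_assoc, Set.inter_self] at h3
    refine h3.trans (mul_le_mul' (mul_le_mul' ?_ ?_) ?_)
    · exact piPerc_grp_le _ _ _ 0
        ![Sum.inl (Sum.inl 0), Sum.inl (Sum.inl 1), Sum.inl (Sum.inl 2), Sum.inl (Sum.inl 4)] (by decide)
        (by decide) (by funext m; fin_cases m <;> rfl) (piPerc_iotaStart_one_ne_le_blockPiota p ι u w _)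
    · exact piPerc_grp_le _ _ _ 1 ![Sum.inl (Sum.inr 0), Sum.inr 0, Sum.inl (Sum.inl 3)] (by decide) (by decide)
        (by funext m; fin_cases m <;> rfl) (piPerc_mid_one_zero_le_blockAbar' p hv hw rfl htu _)
    · exact piPerc_grp_le _ _ _ 2 ![Sum.inr 2, Sum.inr 3] (by decide) (by decide)
        (by funext m; fin_cases m <;> rfl) (piPerc_end_zero_le_blockPE p rfl _ rfl)

/-- **The class `(a,b) = (1,0)` of (6.4) at `N = 1` for the `ι`-event** — the cell `h2 (1,0)` of
`NobleBoundsN1IotaReduce.tsum_ofReal_nobleXiIotaN_one_le_of_cls₁₂` with `E ι x := jointWitIota ι x`.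
[cite: FitznerVanDerHofstad2017, §6.1 proof of Lemma 5.3, (6.4) class (a,b) = (1,0) (arXiv:1506.07977v2 pp. 58–59)] -/
theorem jointWitIota_cls_one_zero (ι : Fin d × Bool) (x u v w z t : Site d) :
    ENNReal.ofReal (bondJ d p (v - u)) * piPerc d p 2 (jointWitIota ι x u v w z t ∩ clsSet u w t z 1 0) ≤
      ∑ κ : Fin d × Bool, (if v = u + stepVec κ then (1 : ℝ≥0∞) else 0) *
        (blockPiota (Letters.perc d p) ι 1 u w * blockAbar' (Letters.perc d p) κ 1 0 u w t z *
          blockPE (Letters.perc d p) 0 (t - x) (z - x)) := by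
  by_cases hu : u = stepVec ι
  exacts [jointWitIota_cls_one_zero_of_eq p hu x v w z t, jointWitIota_cls_one_zero_of_ne p hu x v w z t]

end

end Literature.Probability.FitznerVanDerHofstad2017
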